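import Summits.Ventures.CertifiedManyBodySolver.Downfold.BoxesLa214
import Literature.MathematicalPhysics.QuantumLattice.DWaveSourceEnergyDensityTPPTransport
import HarnessLib

/-!
# The ORDER-word seam along `t''`: hubbard-fast's variational pair-amplitude ceiling for object M,
# read ON a typed one-band material box

Venture CertifiedManyBodySolver, cell `pub/hubbard-downfold` (stage S1 ↔ S2 seam), seat hubbard-downfold-mod-1;
namespace `Summit.Ventures.CertifiedManyBodySolver.Downfold`. Companion of `TppSeamFilling.lean` (the ENERGY
word of the `t–t'–t''` object M of a material box from an object-E window, allowance `C·m`,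
`m = max |tpp/t entry|`). This file does the same for the one ORDER-side statement the tree holds today:
`Literature/…/DWaveSourceEnergyDensityTPPTransport.lean` §4 (hubbard-fast-p1 / hubbard-fast-lit,
`meanEnergy_pairSource_le_of_windows_couplings4` and its `ε = 0` / ABSENT forms): ONE certified object-E
pair at an ANCHOR `(t'₀, U₀, μ₀)` — `e_src(t'₀,U₀,μ₀,0) ≤ hi₀`, `lo ≤ e_src(t'₀,U₀,μ₀,h)`, `h > 0` — bounds the
`d`-wave pair amplitude `e_P(σ)` of every translation-invariant (near-)minimiser `σ` of the source-free
object M `H_M − μN` at ANY `(t', t'', U, μ)` by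
`(hi₀ − lo + 8|t' − t'₀| + |U − U₀| + 2|μ − μ₀| + (32/π²)|t''| + ε)/h`.

On a typed box `B` (entries `eS, eSS, eU` for `tp/t, tpp/t, U/t`) the three coupling costs are bounded by
box data: `|p tp/t − t'₀| ≤ eS.dev t'₀`, `|p U/t − U₀| ≤ eU.dev U₀` (the DEVIATION RADIUS of an entry about
the anchor, §1) and `|p tpp/t| ≤ m`. Hence (§2):

* `holdsOn_pairAmplitude_le_of_anchor` — on `B`, for every chemical potential `μ`, every `ε ≥ 0`-near
  translation-invariant minimiser `σ` of source-free object M at the member's couplings has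
  `e_P(σ) ≤ (hi₀ − lo + 8·eS.dev t'₀ + eU.dev U₀ + 2|μ − μ₀| + (32/π²)·m + ε)/h`;
  `…_of_minimiser` — the `ε = 0` form (translation-invariant ground states of `H_M − μN`);
* `holdsOn_pairAmplitude_lt_of_anchor_near` — THE ABSENT(`< m₀`) WORD ON THE BOX, uniform over a
  chemical-potential interval `[μlo, μhi]`: if
  `8·eS.dev t'₀ + eU.dev U₀ + 2·max |μlo − μ₀| |μhi − μ₀| + (32/π²)·m < h·m₀ − (hi₀ − lo)` then no
  translation-invariant ground state of object M at any member's couplings and any `μ ∈ [μlo, μhi]` has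
  `d`-wave pair amplitude `≥ m₀`;
* `holdsOn_oneBand_of_cell₃` — the product-cell adapter for S2 order words stated directly on
  `(tp/t, tpp/t, U/t)` cells (no filling coordinate: order words live at chemical potential `μ`);
* §3 the La-214 object-M box of record `boxLa214M_M15` (BoxesLa214, p478802): deviation radii about the
  MIDPOINT anchor `(t'₀, U₀) = (−1/10, 10)` are `7/100` and `37/10`, so the single-anchor word costs
  `8·(7/100) + 37/10 + (32/π²)(7/50) ≤ 4.714` (units of `t`) before the `μ` term
  (`boxLa214M_M15_pairAmplitude_le_midAnchor`, `la214M_M15_orderSeam_cost_le`) — i.e. the `U/t` WIDTH of a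
  downfolded box (`[6.3, 13.7]`), not `t''`, is what makes a single-anchor order word vacuous; S2 covers in
  `U` (cells of half-width `≤ 1/2` cost `≤ 1.514`) are the intended consumers of §2, cell by cell, glued by
  `HoldsOn.of_refines`.

Everything here is PROVED; one new definition (`Entry.dev`). HONEST FRAMING: ceiling-side (ABSENT-side)
bookkeeping at the VARIATIONAL level exactly as the Literature file (translation-invariant mean-energy
minimisers at source `0`; the torus-limit order parameter `m⋆` of object M is not defined in the tree);
nothing here FLOORS order or bears on `T_c`; `μ ↔ n` is NOT resolved here — a material box carries the
filling `n`, the word is uniform over a `μ`-interval the S2 side must choose to contain the chemical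
potentials of the box's fillings; the box values are screening-grade S1 output; no number about any material
is certified by this file.
-/

noncomputable section

namespace Summit.Ventures.CertifiedManyBodySolver.Downfold

open NonemptyInterval Literature.MathematicalPhysics.QuantumLattice
  Literature.MathematicalPhysics.QuantumLattice.ThermodynamicLimit Literature.Probability.LatticeModels

/-! ### §1 The deviation radius of an entry about an anchor -/

/-- **Deviation radius of an entry about an anchor `a`**: `max |lo − a| |hi − a|` — the largest distance from
`a` to a point of the claimed enclosure `[lo, hi]` (the coupling-transport cost a box pays to reach an S2
anchor). [cite: Moore1966, §3.1] -/
def Entry.dev (e : Entry) (a : ℝ) : ℝ :=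
  max |((e.encl.fst : ℚ) : ℝ) - a| |((e.encl.snd : ℚ) : ℝ) - a|

/-- The deviation radius is non-negative. [folklore] -/
theorem Entry.dev_nonneg (e : Entry) (a : ℝ) : 0 ≤ e.dev a :=
  le_max_of_le_left (abs_nonneg _)

/-- **Every member of an entry is within the deviation radius of the anchor**: `e.Mem x → |x − a| ≤ e.dev a`.
[cite: Moore1966, §3.1] -/
theorem Entry.abs_sub_le_dev_of_mem {e : Entry} {x : ℝ} (hx : e.Mem x) (a : ℝ) : |x - a| ≤ e.dev a := by
  have h := mem_ratCast_iff.1 hx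
  exact abs_le_max_abs_abs (sub_le_sub_right h.1 a) (sub_le_sub_right h.2 a)

/-- The deviation radius of a printed interval `[lo, hi]`. [folklore] -/
theorem Entry.dev_ofEnds (lo hi : ℚ) (h : lo ≤ hi) (g : Grade) (a : ℝ) :
    (Entry.ofEnds lo hi h g).dev a = max |(lo : ℝ) - a| |(hi : ℝ) - a| := by
  rw [Entry.dev, Entry.encl_ofEnds_fst, Entry.encl_ofEnds_snd]

/-- At the MIDPOINT anchor the deviation radius is the half-width. [folklore] -/
theorem Entry.dev_ofEnds_midpoint (lo hi : ℚ) (h : lo ≤ hi) (g : Grade) :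
    (Entry.ofEnds lo hi h g).dev (((lo : ℝ) + hi) / 2) = ((hi : ℝ) - lo) / 2 := by
  rw [Entry.dev_ofEnds]
  have hle : (lo : ℝ) ≤ hi := by exact_mod_cast h
  rw [abs_of_nonpos (by linarith), abs_of_nonneg (by linarith), max_eq_right (by linarith)]
  ring

/-! ### §2 The order-word seam: one object-E anchor pair ⇒ a pair-amplitude ceiling on the box -/

/-- **THE ORDER-WORD SEAM (near-minimisers, every `μ`).** Let `B` carry entries `eS, eSS, eU` for `tp/t`,
`tpp/t`, `U/t`; let ONE object-E pair be certified at the anchor `(t'₀, U₀, μ₀)`: `e_src(t'₀,U₀,μ₀,0) ≤ hi₀`,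
`lo ≤ e_src(t'₀,U₀,μ₀,h)`, `h > 0`. Then on `B`: for every chemical potential `μ`, every `ε`, and every
translation-invariant state `σ` whose source-free object-M mean energy at the member's couplings
`(1, p tp/t, p tpp/t, p U/t; μ)` is within `ε` of the minimum,
`e_P(σ) ≤ (hi₀ − lo + 8·eS.dev t'₀ + eU.dev U₀ + 2|μ − μ₀| + (32/π²)·m + ε)/h`, `m = max |eSS.lo| |eSS.hi|`.
[cite: KomaTasaki1994, §1] -/
theorem holdsOn_pairAmplitude_le_of_anchor {B : OneBandBox} {eS eSS eU : Entry}
    (hS : B .tpOverT = some eS) (hSS : B .tppOverT = some eSS) (hU : B .UOverT = some eU)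
    {t'₀ U₀ μ₀ h hi₀ lo : ℝ} (hh : 0 < h) (hhi : dWaveSourceEnergyDensityTT' t'₀ U₀ μ₀ 0 ≤ hi₀)
    (hlo : lo ≤ dWaveSourceEnergyDensityTT' t'₀ U₀ μ₀ h) :
    HoldsOn (fun p : OneBandCoord → ℝ => ∀ (μ ε : ℝ) (σ : InfVolFermionState 2), σ.IsTranslationInvariant →
      σ.meanEnergy (hubbardTT'T''SourcedInteraction 1 (p .tpOverT) (p .tppOverT) (p .UOverT) μ
          dWaveFormFactor 0) 2 ≤
        (hubbardTT'T''SourcedInteraction 1 (p .tpOverT) (p .tppOverT) (p .UOverT) μ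
          dWaveFormFactor 0).tiGroundEnergyDensity 2 + ε →
      σ.meanEnergy (pairSourceInteraction dWaveFormFactor) 1 ≤
        (hi₀ - lo + 8 * eS.dev t'₀ + eU.dev U₀ + 2 * |μ - μ₀| +
          32 / Real.pi ^ 2 * ((max |eSS.encl.fst| |eSS.encl.snd| : ℚ) : ℝ) + ε) / h) B := by
  intro p hp μ ε σ hσ hε
  have hk := meanEnergy_pairSource_le_of_windows_couplings4 hh hhi hlo (p .tpOverT) (p .UOverT) μ
    (p .tppOverT) hσ hε
  have h1 : |p .tpOverT - t'₀| ≤ eS.dev t'₀ := Entry.abs_sub_le_dev_of_mem (hp _ _ hS) t'₀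
  have h2 : |p .UOverT - U₀| ≤ eU.dev U₀ := Entry.abs_sub_le_dev_of_mem (hp _ _ hU) U₀
  have h3 : |p .tppOverT| ≤ ((max |eSS.encl.fst| |eSS.encl.snd| : ℚ) : ℝ) := Entry.abs_le_of_mem (hp _ _ hSS)
  have hπ : 0 ≤ 32 / Real.pi ^ 2 := by positivity
  refine hk.trans (div_le_div_of_nonneg_right ?_ hh.le)
  nlinarith [mul_le_mul_of_nonneg_left h3 hπ]

/-- **`ε = 0`: the translation-invariant GROUND STATES of object M.** Same data; on `B`, for every `μ` and
every translation-invariant mean-energy minimiser `σ` of `H_M − μN` at the member's couplings,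
`e_P(σ) ≤ (hi₀ − lo + 8·eS.dev t'₀ + eU.dev U₀ + 2|μ − μ₀| + (32/π²)·m)/h`.
[cite: BratteliKishimotoRobinson1978, Thm. 2] -/
theorem holdsOn_pairAmplitude_le_of_anchor_of_minimiser {B : OneBandBox} {eS eSS eU : Entry}
    (hS : B .tpOverT = some eS) (hSS : B .tppOverT = some eSS) (hU : B .UOverT = some eU)
    {t'₀ U₀ μ₀ h hi₀ lo : ℝ} (hh : 0 < h) (hhi : dWaveSourceEnergyDensityTT' t'₀ U₀ μ₀ 0 ≤ hi₀)
    (hlo : lo ≤ dWaveSourceEnergyDensityTT' t'₀ U₀ μ₀ h) :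
    HoldsOn (fun p : OneBandCoord → ℝ => ∀ (μ : ℝ) (σ : InfVolFermionState 2),
      σ.IsMeanEnergyMinimiser (hubbardTT'T''SourcedInteraction 1 (p .tpOverT) (p .tppOverT) (p .UOverT) μ
          dWaveFormFactor 0) 2 →
      σ.meanEnergy (pairSourceInteraction dWaveFormFactor) 1 ≤
        (hi₀ - lo + 8 * eS.dev t'₀ + eU.dev U₀ + 2 * |μ - μ₀| +
          32 / Real.pi ^ 2 * ((max |eSS.encl.fst| |eSS.encl.snd| : ℚ) : ℝ)) / h) B := by
  intro p hp μ σ hmin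
  have hk := holdsOn_pairAmplitude_le_of_anchor hS hSS hU hh hhi hlo p hp μ 0 σ hmin.1
    (by rw [add_zero]; exact hmin.meanEnergy_eq.le)
  rwa [add_zero] at hk

/-- The `μ`-cost on an interval: `μ ∈ [μlo, μhi] → |μ − μ₀| ≤ max |μlo − μ₀| |μhi − μ₀|`. [folklore] -/
theorem abs_sub_le_max_of_mem_Icc {μ μlo μhi : ℝ} (hμ : μ ∈ Set.Icc μlo μhi) (μ₀ : ℝ) :
    |μ - μ₀| ≤ max |μlo - μ₀| |μhi - μ₀| :=
  abs_le_max_abs_abs (sub_le_sub_right hμ.1 μ₀) (sub_le_sub_right hμ.2 μ₀)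

/-- **THE ABSENT(`< m₀`) WORD ON THE BOX, uniform over a chemical-potential interval.** Same data, plus a
`μ`-interval `[μlo, μhi]` and a threshold `m₀` with
`8·eS.dev t'₀ + eU.dev U₀ + 2·max |μlo − μ₀| |μhi − μ₀| + (32/π²)·m < h·m₀ − (hi₀ − lo)`. Then on `B`: for
every `μ ∈ [μlo, μhi]`, NO translation-invariant ground state of object M at the member's couplings has
`d`-wave pair amplitude `≥ m₀` — the object-M «absent beyond `m₀`» word of a material box read off ONE
object-E certificate pair, with the model-form residual `(32/π²)·m` and the box's own coupling radii in the
budget. [cite: KomaTasaki1994, §1] -/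
theorem holdsOn_pairAmplitude_lt_of_anchor_near {B : OneBandBox} {eS eSS eU : Entry}
    (hS : B .tpOverT = some eS) (hSS : B .tppOverT = some eSS) (hU : B .UOverT = some eU)
    {t'₀ U₀ μ₀ h hi₀ lo μlo μhi m₀ : ℝ} (hh : 0 < h) (hhi : dWaveSourceEnergyDensityTT' t'₀ U₀ μ₀ 0 ≤ hi₀)
    (hlo : lo ≤ dWaveSourceEnergyDensityTT' t'₀ U₀ μ₀ h)
    (hnear : 8 * eS.dev t'₀ + eU.dev U₀ + 2 * max |μlo - μ₀| |μhi - μ₀| +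
      32 / Real.pi ^ 2 * ((max |eSS.encl.fst| |eSS.encl.snd| : ℚ) : ℝ) < h * m₀ - (hi₀ - lo)) :
    HoldsOn (fun p : OneBandCoord → ℝ => ∀ μ ∈ Set.Icc μlo μhi, ∀ σ : InfVolFermionState 2,
      σ.IsMeanEnergyMinimiser (hubbardTT'T''SourcedInteraction 1 (p .tpOverT) (p .tppOverT) (p .UOverT) μ
          dWaveFormFactor 0) 2 →
      σ.meanEnergy (pairSourceInteraction dWaveFormFactor) 1 < m₀) B := by
  intro p hp μ hμ σ hmin
  have hk := holdsOn_pairAmplitude_le_of_anchor_of_minimiser hS hSS hU hh hhi hlo p hp μ σ hmin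
  have hμ' := abs_sub_le_max_of_mem_Icc hμ μ₀
  refine hk.trans_lt ?_
  rw [div_lt_iff₀ hh]
  linarith

/-- **Product-cell adapter for S2 order words** (no filling coordinate: order words live at chemical
potential `μ`). Let `B` carry entries `eS, eSS, eU` for `tp/t, tpp/t, U/t` and let `W₁ s s'' u` be proved on
the product of the three enclosures. Then `p ↦ W₁ (p tp/t) (p tpp/t) (p U/t)` holds on `B`. [folklore] -/
theorem holdsOn_oneBand_of_cell₃ {B : OneBandBox} {eS eSS eU : Entry}
    (hS : B .tpOverT = some eS) (hSS : B .tppOverT = some eSS) (hU : B .UOverT = some eU)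
    {W₁ : ℝ → ℝ → ℝ → Prop}
    (hW : ∀ s s'' u : ℝ, s ∈ eS.encl.ratCast ℝ → s'' ∈ eSS.encl.ratCast ℝ → u ∈ eU.encl.ratCast ℝ →
      W₁ s s'' u) :
    HoldsOn (fun p : OneBandCoord → ℝ => W₁ (p .tpOverT) (p .tppOverT) (p .UOverT)) B :=
  fun _ hp => hW _ _ _ (hp _ _ hS) (hp _ _ hSS) (hp _ _ hU)

/-- **Budget bookkeeping**: the single-anchor numerator splits as
`(hi₀ − lo) + [8·devS + devU + (32/π²)·m] + 2|μ − μ₀| (+ ε)` — the bracket is the BOX COST, paid once per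
anchor whatever the certificate pair. [folklore] -/
theorem orderSeam_numerator_split (hi₀ lo dS dU m μ μ₀ ε : ℝ) :
    hi₀ - lo + 8 * dS + dU + 2 * |μ - μ₀| + 32 / Real.pi ^ 2 * m + ε =
      (hi₀ - lo) + (8 * dS + dU + 32 / Real.pi ^ 2 * m) + 2 * |μ - μ₀| + ε := by
  ring

/-! ### §3 The La-214 object-M box of record `boxLa214M_M15`: the single-anchor cost is the `U/t` width -/

/-- Deviation radius of `tp/t ∈ [−0.17, −0.03]` about the midpoint anchor `t'₀ = −1/10`: `7/100`. [folklore] -/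
theorem la214M_M15_tp_dev_mid : la214M_M15_tp.dev (-1/10) = 7/100 := by
  rw [la214M_M15_tp, Entry.dev_ofEnds]
  norm_num [abs_of_nonpos, abs_of_nonneg]

/-- Deviation radius of `U/t ∈ [6.3, 13.7]` about the midpoint anchor `U₀ = 10`: `37/10`. [folklore] -/
theorem la214M_M15_U_dev_mid : la214M_M15_U.dev 10 = 37/10 := by
  rw [la214M_M15_U, Entry.dev_ofEnds]
  norm_num [abs_of_nonpos, abs_of_nonneg]

/-- **The La-214 M15 object-M order word from ONE object-E pair at the midpoint anchor** `(−1/10, 10, μ₀)`: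
on `boxLa214M_M15`, every translation-invariant ground state of `H_M − μN` at the member's `(tp/t, tpp/t, U/t)`
and any `μ` has `e_P(σ) ≤ (hi₀ − lo + 8·(7/100) + 37/10 + 2|μ − μ₀| + (32/π²)(7/50))/h`.
[cite: BratteliKishimotoRobinson1978, Thm. 2] -/
theorem boxLa214M_M15_pairAmplitude_le_midAnchor {μ₀ h hi₀ lo : ℝ} (hh : 0 < h)
    (hhi : dWaveSourceEnergyDensityTT' (-1/10) 10 μ₀ 0 ≤ hi₀)
    (hlo : lo ≤ dWaveSourceEnergyDensityTT' (-1/10) 10 μ₀ h) :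
    HoldsOn (fun p : OneBandCoord → ℝ => ∀ (μ : ℝ) (σ : InfVolFermionState 2),
      σ.IsMeanEnergyMinimiser (hubbardTT'T''SourcedInteraction 1 (p .tpOverT) (p .tppOverT) (p .UOverT) μ
          dWaveFormFactor 0) 2 →
      σ.meanEnergy (pairSourceInteraction dWaveFormFactor) 1 ≤
        (hi₀ - lo + 8 * (7/100 : ℝ) + 37/10 + 2 * |μ - μ₀| + 32 / Real.pi ^ 2 * (7/50 : ℝ)) / h)
      boxLa214M_M15 := by
  have hk := holdsOn_pairAmplitude_le_of_anchor_of_minimiser (B := boxLa214M_M15) (eS := la214M_M15_tp)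
    (eSS := la214M_M15_tpp) (eU := la214M_M15_U) rfl rfl rfl hh hhi hlo
  rw [la214M_M15_tp_dev_mid, la214M_M15_U_dev_mid, la214M_M15_tpp_abs] at hk
  have hc : (((7/50 : ℚ)) : ℝ) = (7/50 : ℝ) := by norm_num
  rw [hc] at hk
  exact hk

/-- **The single-anchor BOX COST of `boxLa214M_M15` is at most `4.714` (units of `t`)**:
`8·(7/100) + 37/10 + (32/π²)(7/50) ≤ 0.56 + 3.7 + 0.454` (`π > 3.141592`). Of this, `3.7` is the `U/t`
half-width — the `t''` residual is `< 0.454` and the `t'` transport `0.56`: an ABSENT word through ONE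
anchor needs `h·m₀ − (hi₀ − lo) > 4.714 + 2|μ − μ₀|`, i.e. it is the `U/t` WIDTH of the downfolded box that
must be covered by several anchors, not the model-form residual. [folklore] -/
theorem la214M_M15_orderSeam_cost_le :
    8 * (7/100 : ℝ) + 37/10 + 32 / Real.pi ^ 2 * (7/50 : ℝ) ≤ 4.714 := by
  have hπ : (3.141592 : ℝ) < Real.pi := Real.pi_gt_d6
  have hπ2 : (3.141592 : ℝ) ^ 2 < Real.pi ^ 2 := pow_lt_pow_left₀ hπ (by norm_num) (by norm_num)
  have hπ0 : (0 : ℝ) < Real.pi ^ 2 := by positivity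
  have h32 : 32 / Real.pi ^ 2 * (7/50 : ℝ) ≤ 0.454 := by
    rw [div_mul_eq_mul_div, div_le_iff₀ hπ0]
    nlinarith
  linarith

/-- **What a `U`-cover buys** (bookkeeping): with `U/t` cells of half-width `1/2` (one anchor per cell, the
`tp/t` and `tpp/t` entries unchanged) the per-cell box cost is `8·(7/100) + 1/2 + (32/π²)(7/50) ≤ 1.514`.
[folklore] -/
theorem la214M_M15_orderSeam_cost_halfWidthHalf_le :
    8 * (7/100 : ℝ) + 1/2 + 32 / Real.pi ^ 2 * (7/50 : ℝ) ≤ 1.514 := by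
  have h := la214M_M15_orderSeam_cost_le
  linarith

end Summit.Ventures.CertifiedManyBodySolver.Downfold

end
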